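import Summits.QuantumFields.YangMills.Cruxes.GapAtCorrelationLength.RestateKit
import Summits.QuantumFields.YangMills.Cruxes.SelfNormalisedMomentBoundsR.MaskedSectorObstruction

/-!
# r1 strategist (cstrat-stmt-QuantumFields-8646-r1): CERTIFIED GLUE of the repaired split of `HypercubicLimit`

Parent: `Summit.QuantumFields.YangMills.Theses.CoincidenceRotationBootstrap.HypercubicLimit` (stmt-QuantumFields-16154;
its pre-re-type twin stmt-QuantumFields-8646 = `MirrorModularBoosts.HypercubicLimit` follows by the landed
`hypercubicLimit_of_coincidenceRotationBootstrap`, p147954).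

Children (texts EXACTLY as filed in `children.json`; each is `Iff.rfl` to its authoring decl):
* `GapAtCorrelationLengthLocal`  (W₁ᴸ) = `Cruxes.GapAtCorrelationLength.RestateKit.GapAtCorrelationLengthLocal` — the REPAIRED W₁
  (stmt-18927 judged refuted-misstated modulo `PersistentSlabCorrelation`; repair = RP-spectral conjunct over the LOCAL slab class);
* `SelfNormalisedMomentBoundsRS` (U_RS) = `Cruxes.SelfNormalisedMomentBoundsR.Strategist.SelfNormalisedMomentBoundsRS` — the REPAIRED U_R
  (stmt-18014 HELD by `SelfNormalisedMomentBoundsR_false_of_TwoRatePairScheme`; repair = `IsCompactSimpleLieGroup G →` inserted);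
* `SelfNormalisedSkewnessGapped`  (W₂ᴳ) = `Theses.ScalingWindowSplit.SelfNormalisedSkewnessGapped` verbatim (stmt-18170, open, BC3-vetted line).

Glue (children order): `HypercubicLimit_of_subs : W₁ᴸ → U_RS → W₂ᴳ → HypercubicLimit` — the landed
`existenceLegFromLatticeGapped_proof` with the LOCAL seam `ContinuumFromLatticeGap.oneField_of_latticeInequalities_local`
and U_RS fed the consumer's simplicity hypothesis `hG`.  Sorry-free; `#print axioms` at the end.
-/

namespace H21Probe.RepairedSplit

-- the gate's route-file boilerplate (Theses/CoincidenceRotationBootstrap.lean lines 331–332), so the bodies below elaborate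
-- exactly as they will inside the re-rendered route file
open scoped BigOperators Topology Manifold Classical MeasureTheory ProbabilityTheory Matrix InnerProductSpace ComplexConjugate ContinuousMap
open Filter Set Function TopologicalSpace MeasureTheory

/-- child 1 · W₁ᴸ · crux — text as filed. -/
def GapAtCorrelationLengthLocal : Prop :=
  open Literature.MathematicalPhysics.QuantumLattice Literature.MathematicalPhysics.AQFT Literature.MathematicalPhysics.QuantumFieldTheory in let E := EuclideanSpace ℝ (Fin 4); ∀ (G : Type) [Group G] [TopologicalSpace G] [IsTopologicalGroup G] [CompactSpace G], IsCompactSimpleLieGroup G → letI : MeasurableSpace G := borel G; haveI : BorelSpace G := ⟨rfl⟩; ∃ (r : LatticeRep G) (sch : SpeciesScheme (YMSpecies G)) (u : SchwartzMap E ℝ) (p : ℕ) (M Δ C : ℝ), let bare : SpeciesScheme (YMSpecies G) := { sch with c := fun _ _ => 1, m := fun _ _ => 0 }; let T : SchwartzMap E ℝ → ℕ → ℝ := fun w k => latticeSchwinger r.ρ bare (fun s => s.F) k (1 + 1) (fun _ => r.curvature) ![w, thetaTest 4 w] - latticeSchwinger r.ρ bare (fun s => s.F) k 1 (fun _ =>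 r.curvature) ![w] * latticeSchwinger r.ρ bare (fun s => s.F) k 1 (fun _ => r.curvature) ![thetaTest 4 w]; sch.HasWeakCouplingLimit ∧ (∃ N : ℕ, 1 ≤ N ∧ ∀ᶠ k in Filter.atTop, (sch.a k)⁻¹ ≤ (sch.a k * (sch.L k : ℝ)) ^ N) ∧ 0 < Δ ∧ HasLatticeMassGap r sch Δ ∧ (∀ᶠ k in Filter.atTop, ∀ (S₀ T₀ n R : ℕ), sch.L k ≤ S₀ → 2 * (T₀ + n + 1) ≤ S₀ → 2 * (R + 1) ≤ S₀ → ∀ (Y : LGConfig 4 G → ℝ) (B : ℝ), Measurable Y → (∀ U, |Y U| ≤ B) → DependsOn Y {e : Literature.MathematicalPhysics.QuantumLattice.ZdEdge 4 | (1 ≤ e.1 0 ∧ e.1 0 + (if e.2 = 0 then 1 else 0) ≤ T₀) ∧ ∀ i : Fin 4, i ≠ 0 → |e.1 i| ≤ R} → |(∫ U, Y (torusLift (2 * S₀ + 1) (GaugeConfig.timeReflect U)) * Y (configShift (-Pi.single 0 (n : ℤ)) (torusLift (2 * S₀ + 1) U)) ∂(wilsonMeasure r.ρ (sch.β k) : Measure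 (GaugeConfig 4 (2 * S₀ + 1) G))) - (∫ U, Y (torusLift (2 * S₀ + 1) U) ∂(wilsonMeasure r.ρ (sch.β k) : Measure (GaugeConfig 4 (2 * S₀ + 1) G))) ^ 2| ≤ Real.exp (-(Δ * sch.a k * n)) * ((∫ U, Y (torusLift (2 * S₀ + 1) (GaugeConfig.timeReflect U)) * Y (torusLift (2 * S₀ + 1) U) ∂(wilsonMeasure r.ρ (sch.β k) : Measure (GaugeConfig 4 (2 * S₀ + 1) G))) - (∫ U, Y (torusLift (2 * S₀ + 1) U) ∂(wilsonMeasure r.ρ (sch.β k) : Measure (GaugeConfig 4 (2 * S₀ + 1) G))) ^ 2) + C * B ^ 2 * Real.exp (-(Δ * sch.a k * S₀))) ∧ tsupport u ⊆ {y : E | y 0 < 0} ∧ ∀ᶠ k in Filter.atTop, (sch.a k) ^ p ≤ T u k ∧ T u k ≤ M * T (timeShiftTest 4 (-1) u) k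

/-- child 2 · U_RS · crux — text as filed. -/
def SelfNormalisedMomentBoundsRS : Prop :=
  open Literature.MathematicalPhysics.QuantumLattice Literature.MathematicalPhysics.AQFT Literature.MathematicalPhysics.QuantumFieldTheory in let E := EuclideanSpace ℝ (Fin 4); ∀ (G : Type) [Group G] [TopologicalSpace G] [IsTopologicalGroup G] [CompactSpace G] [MeasurableSpace G] [BorelSpace G], IsCompactSimpleLieGroup G → ∀ (r : LatticeRep G) (sch : SpeciesScheme (YMSpecies G)) (u : SchwartzMap E ℝ) (p : ℕ) (M : ℝ), let bare : SpeciesScheme (YMSpecies G) := { sch with c := fun _ _ => 1, m := fun _ _ => 0 }; let T : SchwartzMap E ℝ → ℕ → ℝ := fun w k => latticeSchwinger r.ρ bare (fun s => s.F) k (1 + 1) (fun _ => r.curvature) ![w, thetaTest 4 w] - latticeSchwinger r.ρ bare (fun s => s.F) k 1 (fun _ => r.curvature) ![w] * latticeSchwinger r.ρ bare (fun s => s.F) k 1 (fun _ => r.curvature) ![thetaTest 4 w]; let canon : SpeciesScheme (YMSpecies G) := { sch with c := fun _ k => (Real.sqrt (T u k))⁻¹, m := fun _ k => ∫ U, r.curvature.F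 (torusLift (sch.side k) U) ∂(wilsonMeasure r.ρ (sch.β k)) }; sch.HasWeakCouplingLimit → (∃ N : ℕ, 1 ≤ N ∧ ∀ᶠ k in Filter.atTop, (sch.a k)⁻¹ ≤ (sch.a k * (sch.L k : ℝ)) ^ N) → tsupport u ⊆ {y : E | y 0 < 0} → (∀ᶠ k in Filter.atTop, (sch.a k) ^ p ≤ T u k ∧ T u k ≤ M * T (timeShiftTest 4 (-1) u) k) → ∃ (s : ℕ) (C₀ C₁ : ℝ), ∀ (n : ℕ) (F : Fin n → {q : Fin 4 × Fin 4 // q.1 < q.2} → SchwartzMap E ℝ), (∀ i, ∑ q, schwartzNorm s (ofRealTest (F i q)) ≤ 1) → (∀ i j, i ≠ j → ∀ q q', Disjoint (tsupport (F i q)) (tsupport (F j q'))) → ∀ k : ℕ, |∫ U, ∏ i, ∑ q : {q : Fin 4 × Fin 4 // q.1 < q.2}, smearedLatticeField (plaquetteObs r.ρ 0 q.1.1 q.1.2) (Literature.Probability.LatticeModels.box 4 (canon.L k)) (canon.a k) (canon.c r.curvature k) (canon.m r.curvature k / 6) (F i q) (torusLift (canon.side k) U) ∂(wilsonMeasure r.ρ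 (canon.β k) : Measure (GaugeConfig 4 (canon.side k) G))| ≤ C₀ * C₁ ^ n * n.factorial

/-- child 3 · W₂ᴳ · crux — text as filed (verbatim the ScalingWindowSplit decl, dedupes onto stmt-QuantumFields-18170). -/
def SelfNormalisedSkewnessGapped : Prop :=
  open Literature.MathematicalPhysics.QuantumLattice Literature.MathematicalPhysics.AQFT Literature.MathematicalPhysics.QuantumFieldTheory in let E := EuclideanSpace ℝ (Fin 4); ∀ (G : Type) [Group G] [TopologicalSpace G] [IsTopologicalGroup G] [CompactSpace G] [MeasurableSpace G] [BorelSpace G] (r : LatticeRep G) (sch : SpeciesScheme (YMSpecies G)) (u : SchwartzMap E ℝ) (p : ℕ) (M Δ : ℝ), let bare : SpeciesScheme (YMSpecies G) := { sch with c := fun _ _ => 1, m := fun _ _ => 0 }; let T : SchwartzMap E ℝ → ℕ → ℝ := fun w k => latticeSchwinger r.ρ bare (fun s => s.F) k (1 + 1) (fun _ => r.curvature) ![w, thetaTest 4 w] - latticeSchwinger r.ρ bare (fun s => s.F) k 1 (fun _ => r.curvature) ![w] * latticeSchwinger r.ρ bare (fun s => s.F) k 1 (fun _ => r.curvature) ![thetaTest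 4 w]; let canon : SpeciesScheme (YMSpecies G) := { sch with c := fun _ k => (Real.sqrt (T u k))⁻¹, m := fun _ k => ∫ U, r.curvature.F (torusLift (sch.side k) U) ∂(wilsonMeasure r.ρ (sch.β k)) }; sch.HasWeakCouplingLimit → 0 < Δ → HasLatticeMassGap r sch Δ → (∃ N : ℕ, 1 ≤ N ∧ ∀ᶠ k in Filter.atTop, (sch.a k)⁻¹ ≤ (sch.a k * (sch.L k : ℝ)) ^ N) → tsupport u ⊆ {y : E | y 0 < 0} → (∀ᶠ k in Filter.atTop, (sch.a k) ^ p ≤ T u k ∧ T u k ≤ M * T (timeShiftTest 4 (-1) u) k) → ∃ (f g h : SchwartzMap E ℝ) (δ : ℝ), Disjoint (tsupport f) (tsupport g) ∧ Disjoint (tsupport f) (tsupport h) ∧ Disjoint (tsupport g) (tsupport h) ∧ 0 < δ ∧ ∀ᶠ k in Filter.atTop, δ ≤ |latticeSchwinger r.ρ canon (fun s => s.F) k 3 (fun _ => r.curvature) ![f, g, h] - latticeSchwinger r.ρ canon (fun s => s.F) k 1 (fun _ => r.curvature) ![f] * latticeSchwinger r.ρ canon (fun s => s.F) k 2 (fun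 _ => r.curvature) ![g, h] - latticeSchwinger r.ρ canon (fun s => s.F) k 1 (fun _ => r.curvature) ![g] * latticeSchwinger r.ρ canon (fun s => s.F) k 2 (fun _ => r.curvature) ![f, h] - latticeSchwinger r.ρ canon (fun s => s.F) k 1 (fun _ => r.curvature) ![h] * latticeSchwinger r.ρ canon (fun s => s.F) k 2 (fun _ => r.curvature) ![f, g] + 2 * (latticeSchwinger r.ρ canon (fun s => s.F) k 1 (fun _ => r.curvature) ![f] * latticeSchwinger r.ρ canon (fun s => s.F) k 1 (fun _ => r.curvature) ![g] * latticeSchwinger r.ρ canon (fun s => s.F) k 1 (fun _ => r.curvature) ![h])|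

/-! ## identity with the authoring decls (character-identical bodies) -/

example : GapAtCorrelationLengthLocal ↔
    Summit.QuantumFields.YangMills.Cruxes.GapAtCorrelationLength.RestateKit.GapAtCorrelationLengthLocal := Iff.rfl

example : SelfNormalisedMomentBoundsRS ↔
    Summit.QuantumFields.YangMills.Cruxes.SelfNormalisedMomentBoundsR.Strategist.SelfNormalisedMomentBoundsRS := Iff.rfl

example : SelfNormalisedSkewnessGapped ↔
    Summit.QuantumFields.YangMills.Theses.ScalingWindowSplit.SelfNormalisedSkewnessGapped := Iff.rfl

/-! ## the repairs are weakenings of the current ScalingWindowSplit items (old ⇒ new) -/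

theorem gapAtCorrelationLengthLocal_of_W₁
    (h : Summit.QuantumFields.YangMills.Theses.ScalingWindowSplit.GapAtCorrelationLength) :
    GapAtCorrelationLengthLocal :=
  Summit.QuantumFields.YangMills.Cruxes.GapAtCorrelationLength.RestateKit.gapAtCorrelationLengthLocal_of_gapAtCorrelationLength h

theorem selfNormalisedMomentBoundsRS_of_U_R
    (h : Summit.QuantumFields.YangMills.Theses.ScalingWindowSplit.SelfNormalisedMomentBoundsR) :
    SelfNormalisedMomentBoundsRS :=
  Summit.QuantumFields.YangMills.Cruxes.SelfNormalisedMomentBoundsR.Strategist.selfNormalisedMomentBoundsRS_of_R h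

/-! ## THE GLUE of the split (children order W₁ᴸ, U_RS, W₂ᴳ) -/

/-- `W₁ᴸ → U_RS → W₂ᴳ → CoincidenceRotationBootstrap.HypercubicLimit`. [cite: GlimmJaffe1987, §6.1 and §19.1] -/
theorem HypercubicLimit_of_subs (hW : GapAtCorrelationLengthLocal) (hU : SelfNormalisedMomentBoundsRS)
    (hS : SelfNormalisedSkewnessGapped) :
    Summit.QuantumFields.YangMills.Theses.CoincidenceRotationBootstrap.HypercubicLimit := by
  refine Summit.QuantumFields.YangMills.Theorems.HypercubicLimit.OneFieldWeak.hypercubicLimit_iff_oneFieldWeak.mpr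
    fun G _ _ _ _ hG => ?_
  letI : MeasurableSpace G := borel G
  haveI : BorelSpace G := ⟨rfl⟩
  obtain ⟨r, sch, u, p, M, Δ, C, hw, hpv, hΔ, hgap, hrp, hu, hfw⟩ := hW G hG
  obtain ⟨sch', S₁, hw', h₁⟩ :=
    Summit.QuantumFields.YangMills.Theorems.ContinuumFromLatticeGap.oneField_of_latticeInequalities_local
      r sch u p M Δ C hw hpv hΔ hgap hrp hu hfw
      (hU G hG r sch u p M hw hpv hu hfw) (hS G r sch u p M Δ hw hΔ hgap hpv hu hfw)
  exact ⟨r, sch', S₁, hw', h₁⟩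

/-- The CURRENT ScalingWindowSplit triple still closes the parent through the repaired pieces (so nothing proved on
18927/18014/18170 is lost by the repair). -/
theorem HypercubicLimit_of_currentSWS
    (hW : Summit.QuantumFields.YangMills.Theses.ScalingWindowSplit.GapAtCorrelationLength)
    (hU : Summit.QuantumFields.YangMills.Theses.ScalingWindowSplit.SelfNormalisedMomentBoundsR)
    (hS : Summit.QuantumFields.YangMills.Theses.ScalingWindowSplit.SelfNormalisedSkewnessGapped) :
    Summit.QuantumFields.YangMills.Theses.CoincidenceRotationBootstrap.HypercubicLimit :=
  HypercubicLimit_of_subs (gapAtCorrelationLengthLocal_of_W₁ hW) (selfNormalisedMomentBoundsRS_of_U_R hU) hS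

#print axioms HypercubicLimit_of_subs

end H21Probe.RepairedSplit
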